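import Summits.MatrixMultiplication.OmegaCensus.SmallFormats.GF2OrbitSplit
import HarnessLib

/-!
# ω-census family (a), GF(2) rank floors: splitting one DFS root check over children

Cell `pub-omega` (unit `pub-omega-lit`, gen 5), topic `Summits/MatrixMultiplication/OmegaCensus` (sub-folder
`SmallFormats`). Framing (verbatim): lottery ticket; floor = certified bounds/negative ranges. HONEST FRAMING:
replay infrastructure; nothing here is progress on `ω`. PROVED, no facts.

The replay check `BCert.check` (`Literature/…/SubstitutionBacktracking.lean`) of a big DFS root (the `⟨2,3,3⟩`
certificate has one root with 11 959 leaves) is too much work for one `decide +kernel`. A node passes at depth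
`d` along the path `s` iff `d < maxDepth` and every child `mm` above all entries of `s` passes at depth `d + 1`
along `Fin.snoc s mm` (`check_of_kidOf`); so a data file proves one theorem per (big) child — addressed as
`kidOf t mm`, evaluated by the kernel — and assembles the parent by a case split on `mm`; `rootCheckB_eq`
rewrites a root check into this projected form (`rootsOf`, `tabOf`, `tgtOf`).
-/

namespace Summit.MatrixMultiplication.OmegaCensus.GF2RankLB

open Literature.Computability.AlgebraicComplexity

variable {N : ℕ}

/-- The `mm`-th child of a certificate tree (a leaf is its own child). -/
def kidOf : BCert N → Fin N → BCert N
  | .node cs, mm => cs mm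
  | .leaf F, _ => .leaf F

/-- Is the tree an internal node? -/
def isNodeB : BCert N → Bool
  | .node _ => true
  | .leaf _ => false

/-- `kidOf` of a node. -/
@[simp] theorem kidOf_node (cs : Fin N → BCert N) (mm : Fin N) : kidOf (BCert.node cs) mm = cs mm := rfl

/-- **Splitting a node check over its children**: an internal node passes the replay check at depth `d` along `s`
if `d < maxDepth` and every child above all entries of `s` passes at depth `d + 1` along the extended path. -/
theorem check_of_kidOf {LB : Finset (Fin N) → ℕ} {target maxDepth d : ℕ} (t : BCert N) (s : Fin d → Fin N)
    (ht : isNodeB t = true) (hd : d < maxDepth)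
    (hk : ∀ mm : Fin N, (∀ p : Fin d, s p ≤ mm) →
      (kidOf t mm).check LB target maxDepth (d + 1) (Fin.snoc s mm) = true) :
    t.check LB target maxDepth d s = true := by
  cases t with
  | leaf F => simp [isNodeB] at ht
  | node cs =>
    simp only [BCert.check, Bool.and_eq_true, decide_eq_true_eq]
    exact ⟨hd, fun mm hmm => hk mm hmm⟩


/-- The lookup table of a DFS step (`[]` for the other steps), so that data files can name `lbOf os (tabOf st)`. -/
def tabOf : Step → List (ℕ × ℕ × ℕ × ℕ × ℕ × ℕ)
  | .dfs _ _ _ _ _ table _ => table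
  | _ => []

/-- The target of a DFS step (`0` otherwise). -/
def tgtOf : Step → ℕ
  | .dfs _ target _ _ _ _ _ => target
  | _ => 0

/-- The root certificates of a DFS step (a dummy leaf otherwise). -/
def rootsOf : (st : Step) → Fin (stepN st) → BCert (stepN st)
  | .dfs _ _ _ _ _ _ roots, k => roots k
  | .flat0 _, k => .leaf {k}
  | .flat1 _ _, k => .leaf {k}
  | .flat2 _ _, k => .leaf {k}
  | .look _ _ _ _ _ _, k => .leaf {k}
  | .forced _ _ _ _ _, k => .leaf {k}

/-- `rootCheckB` of a DFS step in terms of the projections (a syntactic rewrite target for the data files). -/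
theorem rootCheckB_eq (os : List Orbit) (st : Step) (k : ℕ) (h : k < stepN st) :
    rootCheckB os st k =
      (rootsOf st ⟨k, h⟩).check (lbOf os (tabOf st)) (tgtOf st) (tgtOf st - 1) 1 (fun _ => ⟨k, h⟩) := by
  cases st with
  | dfs cands target x b c table roots =>
    have h' : k < cands.length := h
    simp only [rootCheckB, rootsOf, tabOf, tgtOf, dif_pos h']
    rfl
  | flat0 _ => simp [stepN] at h
  | flat1 _ _ => simp [stepN] at h
  | flat2 _ _ => simp [stepN] at h
  | look _ _ _ _ _ _ => simp [stepN] at h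
  | forced _ _ _ _ _ => simp [stepN] at h

end Summit.MatrixMultiplication.OmegaCensus.GF2RankLB
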